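import Summits.Ventures.PercRepro.ProfilePointedCircuitClassesTwelveCaptureC

/-!
# PercRepro — THE REPLACEMENT UNIT OF A DEMAND, AND THE PER-SET INEQUALITY FOR THREE-POINT CIRCUITS
(p5, gen 46; `proofs/P5-GM1.md` §68)

On a matroid of nullity `4` and rank `≥ 5`, every bi-independent `4`-set `X` through a point `e` has a
bi-independent `5`-set `T ⊇ X − e` avoiding `e` — the `e`-REPLACEMENT unit `T = (X − e) + b + b'` of §67(g):
`b` is a point of the fundamental circuit of `e` in the basis `B = E ∖ X` outside `cl(X − e)` (one exists, else
`e ∈ cl(C(e, B) − e) ⊆ cl(X − e)`), and `b'` a point of `B` outside `cl(X − e + b)` (one exists since `B` has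
rank `≥ 5 > 4`); `T` is independent, and `E ∖ T = (B − b − b') + e` is independent because `e ∉ cl(B − b)`.
Consequently the per-set inequality (PS) of §67(g) holds for every three-point set `C ∌ e`:
`thru_4(C + e) ≤ #{T ∈ BI_5 : C ⊆ T, e ∉ T}` (`thruCount_four_insert_le_of_card_three`) — the `|C| = 3` case of
«the circuits avoiding `e` pay for themselves» in the per-circuit decomposition of the capture inequality (C).
-/

open scoped Matroid

namespace PercRepro.Cogirth

open Finset ThmH Skew Shadow Profile

variable {α : Type} [DecidableEq α] {N : Matroid α} [N.Finite]

section ReplacementUnit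

/-- A point captured by an independent set lies in the closure of its fundamental circuit (without the point):
`x ∈ cl(fundC N W x)` — the case `S = W ∖ fundC N W x` of `mem_clF_sdiff_of_forall_notMem_fundC`. -/
theorem mem_clF_fundC {x : α} {W : Finset α} (hx : x ∈ gr N) (hWg : W ⊆ gr N) (hWrk : rk N W = W.card)
    (hxcl : x ∈ clF N W) : x ∈ clF N (fundC N W x) := by
  have h := mem_clF_sdiff_of_forall_notMem_fundC hx hWg hWrk hxcl (W \ fundC N W x) sdiff_subset
    (fun w hw => (mem_sdiff.1 hw).2)
  rwa [Finset.sdiff_sdiff_eq_self (fundC_subset W x)] at h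

/-- **EVERY DEMAND HAS A REPLACEMENT UNIT**: on `#E = ρ + 4` with `ρ ≥ 5`, every bi-independent `4`-set `X`
containing `e` has a bi-independent `5`-set `T` with `X − e ⊆ T` and `e ∉ T` — namely `T = (X − e) + b + b'`
with `b ∈ fundC N (E ∖ X) e`, `b ∉ cl(X − e)`, and `b' ∈ E ∖ X`, `b' ∉ cl(X − e + b)`. -/
theorem exists_mem_biIndepSets_five_erase_subset (hn : (gr N).card = rk N (gr N) + 4) (hR : 5 ≤ rk N (gr N))
    {X : Finset α} (hX : X ∈ biIndepSets N 4) {e : α} (he : e ∈ X) :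
    ∃ T ∈ biIndepSets N 5, e ∉ T ∧ X.erase e ⊆ T := by
  obtain ⟨hXg, hX4, hXrk, hXc⟩ := mem_biIndepSets.1 hX
  set B := gr N \ X with hB
  set A := X.erase e with hA
  have heg : e ∈ gr N := hXg he
  have hBg : B ⊆ gr N := sdiff_subset
  have hBcard : B.card = rk N (gr N) := by
    rw [hB, card_sdiff_of_subset hXg, hX4]
    omega
  have hBrk : rk N B = rk N (gr N) := by rw [hXc, hBcard]
  have heB : e ∉ B := fun h => (mem_sdiff.1 h).2 he
  have hecl : e ∈ clF N B := by
    rw [mem_clF_iff_rk_insert_eq heg hBg]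
    have h1 := rk_le_rk_gr (M := N) (insert_subset heg hBg)
    have h2 := rk_le_rk_of_subset_finset (M := N) (subset_insert e B)
    omega
  have hAg : A ⊆ gr N := (erase_subset _ _).trans hXg
  have hArk : rk N A = A.card := rk_eq_card_of_subset_of_rk_eq_card (erase_subset _ _) hXrk
  have hA3 : A.card = 3 := by rw [hA, card_erase_of_mem he, hX4]
  have heA : e ∉ clF N A := notMem_clF_erase_of_indep (indep_of_rk_eq_card' hXrk) he
  have hCcl : e ∈ clF N (fundC N B e) := mem_clF_fundC heg hBg hXc hecl
  -- a point `b` of the fundamental circuit of `e` outside `cl A`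
  obtain ⟨b, hbC, hbA⟩ : ∃ b ∈ fundC N B e, b ∉ clF N A := by
    by_contra hcon
    have hsub : fundC N B e ⊆ clF N A := fun x hx => by_contra (fun h => hcon ⟨x, hx, h⟩)
    exact heA (mem_clF_of_mem_clF_clF hAg (mem_clF_of_subset hsub hCcl))
  have hbB : b ∈ B := fundC_subset B e hbC
  have hbg : b ∈ gr N := hBg hbB
  have hbX : b ∉ X := (mem_sdiff.1 hbB).2
  have hbA' : b ∉ A := fun h => hbX (mem_of_mem_erase h)
  have heb : e ≠ b := fun h => hbX (h ▸ he)
  have heBb : e ∉ clF N (B.erase b) := by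
    unfold fundC at hbC
    exact (mem_filter.1 hbC).2
  set A1 := insert b A with hA1
  have hA1g : A1 ⊆ gr N := insert_subset hbg hAg
  have hA1rk : rk N A1 = 4 := by rw [hA1, rk_insert_eq hbg hAg, if_neg hbA, hArk, hA3]
  have hA1card : A1.card = 4 := by rw [hA1, card_insert_of_notMem hbA', hA3]
  -- a point `b'` of `B` outside `cl A1`
  obtain ⟨b', hb'B, hb'cl⟩ : ∃ b' ∈ B, b' ∉ clF N A1 := by
    by_contra hcon
    have hsub : B ⊆ clF N A1 := fun x hx => by_contra (fun h => hcon ⟨x, hx, h⟩)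
    have h1 := rk_le_rk_of_subset_finset (M := N) hsub
    rw [rk_clF_eq_rk, hA1rk, hBrk] at h1
    omega
  have hb'g : b' ∈ gr N := hBg hb'B
  have hb'A1 : b' ∉ A1 := fun h => hb'cl (subset_clF hA1g h)
  have hb'X : b' ∉ X := (mem_sdiff.1 hb'B).2
  have heb' : e ≠ b' := fun h => hb'X (h ▸ he)
  refine ⟨insert b' A1, ?_, ?_, ?_⟩
  · rw [mem_biIndepSets]
    refine ⟨insert_subset hb'g hA1g, ?_, ?_, ?_⟩
    · rw [card_insert_of_notMem hb'A1, hA1card]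
    · rw [card_insert_of_notMem hb'A1, rk_insert_eq hb'g hA1g, if_neg hb'cl, hA1rk, hA1card]
    · -- the complement lies in the independent set `(B − b) + e`
      have hBe : B.erase b ⊆ gr N := (erase_subset _ _).trans hBg
      have heBe : e ∉ B.erase b := fun h => heB (mem_of_mem_erase h)
      have hI : rk N (insert e (B.erase b)) = (insert e (B.erase b)).card := by
        rw [rk_insert_eq heg hBe, if_neg heBb, card_insert_of_notMem heBe,
          rk_eq_card_of_subset_of_rk_eq_card (erase_subset _ _) hXc]
      apply rk_eq_card_of_subset_of_rk_eq_card _ hI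
      intro x hx
      rw [mem_sdiff] at hx
      obtain ⟨hxg, hxT⟩ := hx
      rw [mem_insert]
      by_cases hxe : x = e
      · exact Or.inl hxe
      · right
        rw [mem_erase, hB, mem_sdiff]
        refine ⟨?_, hxg, ?_⟩
        · intro hxb
          exact hxT (hxb ▸ mem_insert_of_mem (mem_insert_self b A))
        · intro hxX
          exact hxT (mem_insert_of_mem (mem_insert_of_mem (mem_erase.2 ⟨hxe, hxX⟩)))
  · rw [hA1, hA, mem_insert, mem_insert]
    rintro (h | h | h)
    · exact heb' h
    · exact heb h
    · exact (mem_erase.1 h).1 rfl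
  · intro x hx
    exact mem_insert_of_mem (mem_insert_of_mem hx)

/-- **THE PER-SET INEQUALITY FOR A THREE-POINT SET** (§67(g) (PS), `|C| = 3`): on `#E = ρ + 4`, `ρ ≥ 5`, for every
three-point set `C ⊆ E` and every `e ∈ E ∖ C`, the bi-independent `4`-sets through `C + e` (at most one: `C + e`
itself) are at most the bi-independent `5`-sets containing `C` and avoiding `e`. -/
theorem thruCount_four_insert_le_of_card_three (hn : (gr N).card = rk N (gr N) + 4) (hR : 5 ≤ rk N (gr N))
    {C : Finset α} (hC3 : C.card = 3) {e : α} (heC : e ∉ C) :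
    thruCount N 4 (insert e C) ≤ ((biIndepSets N 5).filter (fun T => C ⊆ T ∧ e ∉ T)).card := by
  unfold thruCount
  have hcard : (insert e C).card = 4 := by rw [card_insert_of_notMem heC, hC3]
  -- every set counted on the left is `insert e C` itself
  have hsub : (biIndepSets N 4).filter (fun X => insert e C ⊆ X) ⊆ {insert e C} := by
    intro X hX
    rw [mem_filter] at hX
    rw [mem_singleton]
    have h4 : X.card = 4 := (mem_biIndepSets.1 hX.1).2.1
    exact (eq_of_subset_of_card_le hX.2 (by omega)).symm
  by_cases h : insert e C ∈ biIndepSets N 4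
  · obtain ⟨T, hT, heT, hCT⟩ := exists_mem_biIndepSets_five_erase_subset hn hR h (mem_insert_self e C)
    have hCT' : C ⊆ T := by
      rw [erase_insert heC] at hCT
      exact hCT
    calc ((biIndepSets N 4).filter (fun X => insert e C ⊆ X)).card ≤ ({insert e C} : Finset (Finset α)).card :=
          card_le_card hsub
      _ = 1 := card_singleton _
      _ ≤ ((biIndepSets N 5).filter (fun T => C ⊆ T ∧ e ∉ T)).card :=
          card_pos.2 ⟨T, mem_filter.2 ⟨hT, hCT', heT⟩⟩
  · have hempty : (biIndepSets N 4).filter (fun X => insert e C ⊆ X) = ∅ := by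
      rw [filter_eq_empty_iff]
      intro X hX hXC
      have hX' : X ∈ ({insert e C} : Finset (Finset α)) := hsub (mem_filter.2 ⟨hX, hXC⟩)
      rw [mem_singleton] at hX'
      exact h (hX' ▸ hX)
    rw [hempty, card_empty]
    exact Nat.zero_le _

end ReplacementUnit

end PercRepro.Cogirth
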